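import Summits.ABC.IUTFork.Cor312Statement
import Summits.ABC.IUTFork.Cor312Chain
import Literature.IUT.LogVolume.PilotDivisors
import HarnessLib

/-!
# [IUTchIII] Corollary 3.12, statement — bridges and the vacuity audit

Record-only file (D-0012) of the abc-iut cell (Cor. 3.12 crew, wave 2, seat abc-iut-c312-7; claim W2-B); TAKES NO
SIDE. Companion of `Cor312Statement.lean` (the STATEMENT of [IUTchIII] Cor. 3.12, kurims `paper:url-4b091feeb646`
p. 173 l. 41 – p. 174 l. 19, as the `Prop`-valued `Cor312.Setting.Statement` over c312-1's `Thm311.Situation`).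
NOT to be confused with seat c312-6's `Cor312StatementBridge.lean` (singular; namespace `Cor312Vol`): that file is
the SKELETON-level bridge `Statement ↔ ForkRegions.Cor312Setting.Cor312`; this one (plural; namespace `Cor312`)
holds the statement's own bookkeeping bridges and its vacuity toy, and is the file the landed statement's
docstring calls "the companion `Cor312StatementBridges`".

1. BRIDGES. `statement_iff_cThetaForm` (the printed "i.e., `C_Θ ≥ −1` for any real number `C_Θ` such that
   `−|log(Θ)| ≤ C_Θ·|log(q)|`", PROVED given `|log(q)| > 0`); `statement_iff_real`: when `−|log(Θ)|` is a real number `x`, the Statement is `−|log(q)| ≤ x` over `ℝ`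
   — the shape consumed downstream (skel `ForkThm110.Thm110Data.Cor312`, campaign-S
   `Literature.IUT.LogVolume.Thm110Numerics.Cor312`, c312-1's `PilotNouns.Cor312At`, c312-2's `Cor312Chain.Volumes`);
   `negLogTheta_eq_of_thetaFinite` / `not_statement_of_not_thetaFinite` (the `+∞` branch). `toVolumes` /
   `statement_iff_volumes_cor312` (`Iff.rfl`): the setting's two quantities ARE a `Cor312Proof.Volumes` of
   c312-2's chain (`Cor312Chain.lean`) and the verbatim `Statement` IS its `Volumes.Cor312`, so c312-2's
   `cor312_of_chain` (loci ∧ twenty steps ∧ the two real edges) delivers the verbatim Statement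
   (`statement_of_chain`) — the statement file and the proof-chain files meet here. `absLogQ_pos_of_qPilot`:
   the printed "In particular, `|log(q)| > 0` is easily computed in terms of the various q-parameters of the
   elliptic curve `E_F` [cf. [IUTchI], Definition 3.1, (b)] at `v ∈ 𝕍^bad (≠ ∅)`" (p. 174 l. 13–15) — if `−|log(q)|`
   is a negative multiple of the degree of the q-pilot divisor `P_q = Σ_{v∈S} ord_v(q_v)/(2l)·[v]`
   (`Literature.IUT.LogVolume.PilotData.qPilot`, Dupuy–Hilado §3.3, campaign S; the conversion constant is
   [IUTchIV] Prop. 1.4 / Dupuy–Hilado Thm. 3.10.1, seats c312-3/S2), then `|log(q)| > 0` follows from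
   `deg_qPilot_pos` — PROVED.
2. VACUITY AUDIT (LANA report Rem. 8.2.1; cell rule "vacuity-audit every fork-level hypothesis with a
   non-vacuity witness"): a TOY `Setting` (one valuation, `l⋇ = 2`, trivial indeterminacies, hull-sets `{∅, 𝓘^ℚ}`,
   Θ-pilot region `∅`, q-pilot region everything, log-volume `c` on `∅` and `0` elsewhere) in which
   `−|log(Θ)| = c` and `−|log(q)| = 0` (`toy_statement_iff`): the typed `Statement` HOLDS for `c = 0` and FAILS
   for `c = −1` — it is neither a tautology nor contradictory at the level of the signatures. The toy says
   nothing about IUT. [claim: Mochizuki2012, status: disputed] [cite: LANA2026Report, Rem. 8.2.1 p. 42]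
Deliberately NOT here: any instantiation from real data (W2-A `Thm311Real`, abc-iut-c312-5), any judgement.
-/

noncomputable section

namespace Summit.ABC.IUTFork.Cor312

open Thm311 Literature.IUT.LogThetaLattice

/-! ## 1. Bridges -/

namespace Setting

variable {T : ThetaIndex} {S : Situation T} (P : Setting S)

/-- BRIDGE to the real-number consumers: when `−|log(Θ)|` is the real number `x`, the `Statement` is the
inequality `−|log(q)| ≤ x` over `ℝ` — the shape of skel `ForkThm110.Thm110Data.Cor312`, of
`Literature.IUT.LogVolume.Thm110Numerics.Cor312`, and of c312-1's `PilotNouns.Cor312At`. PROVED. [folklore] -/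
theorem statement_iff_real {x : ℝ} (hx : P.negLogTheta = (x : WithTop ℝ)) :
    P.Statement ↔ P.negLogQ ≤ x := by
  unfold Statement
  rw [hx]
  simp [WithTop.coe_le_coe]

/-- When `ThetaFinite` fails, `−|log(Θ)| = +∞` and the Statement is false as typed ("`−|log(Θ)| ∈ ℝ`" is part
of the conclusion). [folklore] -/
theorem not_statement_of_not_thetaFinite (h : ¬ P.ThetaFinite) : ¬ P.Statement := by
  unfold Statement negLogTheta
  simp [h]

/-- When `ThetaFinite` holds, `−|log(Θ)|` is the displayed real number. [folklore] -/
theorem negLogTheta_eq_of_thetaFinite (h : P.ThetaFinite) :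
    P.negLogTheta = ((processionNormalized fun i : Fin T.lstar =>
        ∑ᶠ vQ : T.VQ, (P.thetaLocal (labelSucc i) vQ).untopD 0 : ℝ) : WithTop ℝ) := by
  unfold negLogTheta
  simp [h]

/-- Under `ThetaFinite` the Statement is the real inequality between the two displayed numbers. [folklore] -/
theorem statement_iff_of_thetaFinite (h : P.ThetaFinite) :
    P.Statement ↔ P.negLogQ ≤ processionNormalized fun i : Fin T.lstar =>
        ∑ᶠ vQ : T.VQ, (P.thetaLocal (labelSucc i) vQ).untopD 0 :=
  P.statement_iff_real (P.negLogTheta_eq_of_thetaFinite h)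

/-- BOOKKEEPING (the "i.e." of p. 174 l. 18): given `|log(q)| > 0`, the printed conclusion and its `C_Θ`-form
are equivalent. PROVED. [folklore] -/
theorem statement_iff_cThetaForm (hq : P.AbsLogQPos) : P.Statement ↔ P.CThetaForm := by
  unfold Statement CThetaForm AbsLogQPos absLogQ at *
  have habs : |P.negLogQ| = -P.negLogQ := abs_of_neg hq
  have hpos : 0 < -P.negLogQ := by linarith
  constructor
  · rintro ⟨hfin, hle⟩
    refine ⟨hfin, fun C hC => ?_⟩
    obtain ⟨x, hx⟩ := WithTop.ne_top_iff_exists.mp hfin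
    rw [← hx] at hle hC
    have h1 : P.negLogQ ≤ x := WithTop.coe_le_coe.mp hle
    have h2 : x ≤ C * |P.negLogQ| := WithTop.coe_le_coe.mp hC
    rw [habs] at h2
    by_contra hlt
    have hlt' : C < -1 := not_le.mp hlt
    have : C * -P.negLogQ < -1 * -P.negLogQ := mul_lt_mul_of_pos_right hlt' hpos
    linarith
  · rintro ⟨hfin, hC⟩
    refine ⟨hfin, ?_⟩
    obtain ⟨x, hx⟩ := WithTop.ne_top_iff_exists.mp hfin
    have hq0 : -P.negLogQ ≠ 0 := hpos.ne'
    have key : -1 ≤ x / -P.negLogQ := by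
      apply hC
      rw [← hx, habs, div_mul_cancel₀ x hq0]
    rw [← hx]
    apply WithTop.coe_le_coe.mpr
    have hmul := mul_le_mul_of_nonneg_right key hpos.le
    rw [div_mul_cancel₀ x hq0] at hmul
    linarith

/-- The two printed quantities of the setting, with `|log(q)| > 0`, as the `Volumes` datum of c312-2's
proof chain (`Cor312Chain.lean`, [IUTchIII] Cor. 3.12 (xi-d) p. 183: "`ℝ_{≤−|log(Θ)|} … ⊆ ℝ; −|log(q)| ∈ ℝ`").
[claim: Mochizuki2012, status: disputed] -/
def toVolumes (hq : P.AbsLogQPos) : Cor312Proof.Volumes where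
  negLogTheta := P.negLogTheta
  negAbsLogq := P.negLogQ
  negAbsLogq_neg := hq

/-- The verbatim `Statement` IS c312-2's `Volumes.Cor312` of the setting's volumes (definitionally).
[folklore] -/
theorem statement_iff_volumes_cor312 (hq : P.AbsLogQPos) : P.Statement ↔ (P.toVolumes hq).Cor312 :=
  Iff.rfl

/-- Hence c312-2's composition theorem applies verbatim: granting every cited locus, the twenty typed
inferences of the proof (`Cor312Proof.Chain`) and the two real edges (`RealEdges`: finiteness from
compactness; (xi-f) "the inclusion … then follows formally" — THE DISPUTED EDGE, a named hypothesis) yield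
the Statement of Cor. 3.12 for this setting. Bookkeeping only; no edge is asserted. [claim: Mochizuki2012, status: disputed] -/
theorem statement_of_chain (hq : P.AbsLogQPos) {Lc : Cor312Proof.Locus → Prop} {O : Cor312Proof.Obs → Prop}
    (hL : ∀ c, Lc c) (hC : Cor312Proof.Chain Lc O) (hE : Cor312Proof.RealEdges O (P.toVolumes hq)) :
    P.Statement :=
  (P.statement_iff_volumes_cor312 hq).2 (Cor312Proof.cor312_of_chain hL hC hE)

/-- "In particular, `|log(q)| > 0` is easily computed in terms of the various q-parameters of the elliptic
curve `E_F` [cf. [IUTchI], Definition 3.1, (b)] at `v ∈ 𝕍^bad (≠ ∅)`" (p. 174 l. 13–15): if `−|log(q)|` is a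
negative multiple of the degree of the q-pilot divisor of the pilot data `X` (campaign-S
`Literature.IUT.LogVolume.PilotData.qPilot`), then `|log(q)| > 0` — PROVED from `deg_qPilot_pos` (non-empty
`S`, positive valuations of the q-parameters). [folklore] -/
theorem absLogQ_pos_of_qPilot {F : Type*} [Field F] [NumberField F] (X : Literature.IUT.LogVolume.PilotData F)
    (c : ℝ) (hc : 0 < c)
    (h : P.negLogQ = -(c * Literature.IUT.LogVolume.FinDivisor.deg F X.qPilot)) : P.AbsLogQPos := by
  unfold AbsLogQPos
  rw [h, neg_lt_zero]
  exact mul_pos hc X.deg_qPilot_pos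

end Setting

/-! ## 2. Vacuity audit: a toy setting in which the Statement is decidable either way -/

namespace Checks

/-- One valuation over one place, `l⋇ = 2` (`l = 5`), everything nonarchimedean and bad. [folklore] -/
def toyIndex : ThetaIndex where
  lstar := 2
  two_le_lstar := le_rfl
  V := Unit
  VQ := Unit
  over := id
  IsNon := fun _ => True
  fibre_finite := fun _ => Set.toFinite _
  fibre_nonempty := fun _ => ⟨(), rfl⟩
  Vbad := Set.univ
  Vbad_nonempty := ⟨(), trivial⟩
  Vbad_finite := Set.toFinite _
  Vbad_non := fun _ _ => trivial

/-- The toy's set of places of `ℚ` is the one-point type. [folklore] -/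
instance : Unique toyIndex.VQ := inferInstanceAs (Unique Unit)

/-- The toy's set of places of `ℚ` is finite. [folklore] -/
instance : Finite toyIndex.VQ := inferInstanceAs (Finite Unit)

/-- `log(𝒟^⊢_v) := ℚ`, the log-shell all of it, only the identity acting. [folklore] -/
def toyShells : LogShells toyIndex where
  carrier := fun _ => ℚ
  shell := fun _ => Set.univ
  stripAut := fun _ => {LinearEquiv.refl ℚ ℚ}
  ism := fun _ => {LinearEquiv.refl ℚ ℚ}
  one_mem_stripAut := fun _ => rfl
  one_mem_ism := fun _ => rfl

open scoped Classical in
/-- Data (a)(b)(c): everything admissible; log-volume `c` on the empty region and `0` elsewhere. [folklore] -/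
def toyData (c : ℝ) : MRData toyShells where
  shellPk := fun _ _ => Set.univ
  shellSub := fun _ _ => Set.univ
  Adm := fun _ _ _ => True
  logvol := fun _ _ A => if A = ∅ then c else 0
  Ψ := fun _ _ => ∅
  act := fun _ _ _ => 0
  Mmod := fun _ => ∅

/-- The toy log-volume of the empty region is `c`. [folklore] -/
theorem toyData_logvol_empty (c : ℝ) (j : toyIndex.Label) (vQ : toyIndex.VQ) :
    (toyData c).logvol j vQ ∅ = c := if_pos rfl

/-- The toy log-volume of the whole packet is `0` (the packet is nonempty). [folklore] -/
theorem toyData_logvol_univ (c : ℝ) (j : toyIndex.Label) (vQ : toyIndex.VQ) :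
    (toyData c).logvol j vQ Set.univ = 0 :=
  if_neg (Set.univ_eq_empty_iff.not.mpr (not_isEmpty_of_nonempty _))

/-- One Frobenioid object of degree `0` whose region is everything. [folklore] -/
def toyDegrees (j : toyIndex.LabelStar) : GlobalDegrees toyShells j where
  ObjMOD := Unit
  Objmod := Unit
  natIso := Equiv.refl Unit
  deg := fun _ => 0
  region := fun _ _ => Set.univ

/-- The toy situation (the same data on every vertical line). [folklore] -/
def toySituation (c : ℝ) : Situation toyIndex where
  L := toyShells
  D := fun _ => toyData c
  G := fun _ j => toyDegrees j

/-- The hull frame with hull-sets `∅` and everything, every subset bounded and admitting a hull (this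
family of hull-sets HAS a least element, unlike the boxes `λ·𝒪` of the intended model). [folklore] -/
def toyFrame (X : Type) : HullFrame X where
  Hul := {∅, Set.univ}
  IsBounded := fun _ => True
  HasHull := fun _ => True
  hul_bounded := fun _ _ => trivial
  bounded_mono := fun _ _ _ _ => trivial
  exists_hul := fun _ _ => ⟨Set.univ, Set.mem_insert_of_mem _ rfl, Set.subset_univ _⟩
  hull_mem := fun U _ _ => by
    by_cases hU : U = ∅
    · have hmem : (∅ : Set X) ∈ {H | H ∈ ({∅, Set.univ} : Set (Set X)) ∧ U ⊆ H} :=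
        ⟨Set.mem_insert _ _, by simp [hU]⟩
      have h0 : ⋂₀ {H | H ∈ ({∅, Set.univ} : Set (Set X)) ∧ U ⊆ H} = ∅ :=
        Set.eq_empty_of_subset_empty (Set.sInter_subset_of_mem hmem)
      rw [h0]; exact Set.mem_insert _ _
    · have h1 : {H | H ∈ ({∅, Set.univ} : Set (Set X)) ∧ U ⊆ H} = {Set.univ} := by
        ext H
        simp only [Set.mem_setOf_eq, Set.mem_insert_iff, Set.mem_singleton_iff]
        constructor
        · rintro ⟨rfl | rfl, hsub⟩
          · exact absurd (Set.subset_empty_iff.mp hsub) hU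
          · rfl
        · rintro rfl
          exact ⟨Or.inr rfl, Set.subset_univ _⟩
      rw [h1, Set.sInter_singleton]
      exact Set.mem_insert_of_mem _ rfl

/-- In the toy frame the hull of `∅` is `∅`. [folklore] -/
theorem toyFrame_hull_empty (X : Type) : (toyFrame X).hull ∅ = ∅ := by
  apply Set.eq_empty_of_subset_empty
  exact (toyFrame X).hull_subset_of_mem (Set.mem_insert _ _) subset_rfl

/-- A one-point output of Prop. 3.7 (every Frobenioid, strip and object is a point). [folklore] -/
def toySig : GlobalLGPFrobenioidSignature 2 Unit (· ∈ (Set.univ : Set Unit)) Unit (fun _ _ => Unit)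
    (fun _ => Unit) id Unit (fun _ _ => Unit) (fun _ _ => Unit) where
  FMOD := fun _ => ()
  Fmod := fun _ => ()
  Ffrak := fun _ => ()
  isoModMOD := fun _ => ()
  isoModFrak := fun _ => ()
  isoFrakMOD := fun _ => ()
  CLGP := ()
  Clgp := ()
  FLGP := ()
  Flgp := ()
  Fgau := ()
  isoGauLGP := ()
  isoLGPlgp := ()
  isoCLGPlgp := ()
  embLGP := fun _ _ => ()
  embLgp := fun _ _ => ()
  embLGP_injective := fun a b _ => Subsingleton.elim a b
  embLgp_injective := fun a b _ => Subsingleton.elim a b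
  objOfLgp := fun _ => ()
  objOfLGP := fun _ => ()
  objOfFrak := fun _ _ => ()
  objOfMOD := fun _ _ => ()

/-- The point generates the one-point monoid up to torsion. [folklore] -/
theorem unit_isGenerator (g : Unit) : IsGeneratorUpToTorsion g :=
  fun _ => ⟨(), 1, 0, Nat.one_pos, Subsingleton.elim _ _, Subsingleton.elim _ _⟩

/-- … also as an element of the full submonoid of the point. [folklore] -/
theorem top_unit_isGenerator (g : (⊤ : Submonoid Unit)) : IsGeneratorUpToTorsion g :=
  fun _ => ⟨1, 1, 0, Nat.one_pos, one_pow 1, Subtype.ext (Subsingleton.elim _ _)⟩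

/-- The toy SETTING over `toySituation c`: lattice `^{n,m}𝓗𝓣 := (n, m)`, one-point pilots, hull frame `toyFrame`,
Θ-pilot region `∅` at every `m`, q-pilot region everything. [folklore] -/
def toySetting (c : ℝ) : Setting (toySituation c) where
  n := 0
  HT := ℤ × ℤ
  LogLink := fun _ _ => Unit
  IsFull := fun _ => True
  lattice :=
    { theater := fun n m => (n, m)
      distinct := fun p q h => by simpa using h
      logLink := fun _ _ => ()
      logLink_full := fun _ _ => trivial }
  Frd := Unit
  IsoF := fun _ _ => Unit
  Ob := fun _ => Unit
  realify := id
  Strip := Unit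
  IsoS := fun _ _ => Unit
  M := fun _ _ => Unit
  sig := toySig
  split := { Msplit := fun _ _ => ⊤, exists_gen := fun _ _ => ⟨⟨(), trivial⟩, top_unit_isGenerator _⟩ }
  ObΔ := Unit
  N := fun _ _ => Unit
  qData := { q := fun _ _ => (), q_gen := fun _ _ => unit_isGenerator _, objOf := fun _ => () }
  frame := fun j vQ => toyFrame _
  hul_adm := fun _ _ _ _ => trivial
  thetaRegionOf := fun _ _ _ _ => ∅
  qRegionOf := fun _ _ _ => Set.univ
  qRegion_mem := fun _ _ => Set.mem_insert_of_mem _ rfl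
  qSupport_finite := fun _ => Set.toFinite _

variable (c : ℝ)

/-- In the toy every possible image of the Θ-pilot is empty, so their union is empty. [folklore] -/
theorem toy_sUnion_possibleImages (j : toyIndex.Label) (vQ : toyIndex.VQ) :
    ⋃₀ (toySetting c).possibleImages j vQ = ∅ := by
  apply Set.sUnion_eq_empty.2
  rintro U ⟨Φ, -, rfl⟩
  simp [Setting.thetaRegion3, Setting.thetaRegion, toySetting]

/-- The local Θ-volume of the toy is `c` (the hull of `∅` is `∅`, of log-volume `c`). [folklore] -/
theorem toy_thetaLocal (j : toyIndex.Label) (vQ : toyIndex.VQ) :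
    (toySetting c).thetaLocal j vQ = (c : WithTop ℝ) := by
  have hb : (toySetting c).HullDefined j vQ := ⟨trivial, trivial⟩
  unfold Setting.thetaLocal
  rw [if_pos hb]
  have hh : (toySetting c).thetaHull j vQ = ∅ := by
    unfold Setting.thetaHull
    rw [toy_sUnion_possibleImages]
    exact toyFrame_hull_empty _
  rw [hh]
  show (((toyData c).logvol j vQ ∅ : ℝ) : WithTop ℝ) = c
  rw [toyData_logvol_empty]

/-- The local q-volume of the toy is `0` (the q-pilot region is everything, which is nonempty). [folklore] -/
theorem toy_qLocal (j : toyIndex.Label) (vQ : toyIndex.VQ) : (toySetting c).qLocal j vQ = 0 :=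
  toyData_logvol_univ c j vQ

/-- The toy is `ThetaFinite`. [folklore] -/
theorem toy_thetaFinite : (toySetting c).ThetaFinite :=
  ⟨fun i vQ => by rw [toy_thetaLocal]; exact WithTop.coe_ne_top, fun _ => Set.toFinite _⟩

/-- `−|log(Θ)| = c` in the toy. [folklore] -/
theorem toy_negLogTheta : (toySetting c).negLogTheta = (c : WithTop ℝ) := by
  rw [(toySetting c).negLogTheta_eq_of_thetaFinite (toy_thetaFinite c)]
  simp only [toy_thetaLocal, WithTop.untopD_coe, finsum_unique]
  exact congrArg _ (processionNormalized_const (by decide) c)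

/-- `−|log(q)| = 0` in the toy. [folklore] -/
theorem toy_negLogQ : (toySetting c).negLogQ = 0 := by
  unfold Setting.negLogQ
  simp only [toy_qLocal, finsum_zero]
  exact processionNormalized_const (by decide) 0

/-- In the toy the Statement is the real inequality `0 ≤ c`. [folklore] -/
theorem toy_statement_iff : (toySetting c).Statement ↔ 0 ≤ c := by
  rw [(toySetting c).statement_iff_real (toy_negLogTheta c), toy_negLogQ]

/-- **Non-vacuity, positive side**: the typed Statement of Cor. 3.12 is satisfiable (toy with `c = 0`).
[folklore] -/
theorem statement_satisfiable : (toySetting 0).Statement := (toy_statement_iff 0).2 le_rfl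

/-- **Non-vacuity, negative side**: the typed Statement of Cor. 3.12 is refutable (toy with `c = −1`) — it is
NOT a tautology of the signatures. [folklore] -/
theorem statement_refutable : ¬ (toySetting (-1)).Statement := fun h => by
  have := (toy_statement_iff (-1)).1 h
  linarith

/-- Hence the Statement is CONTENTFUL at this level: some settings satisfy it, some do not. [folklore] -/
theorem statement_contentful :
    (∃ (c : ℝ), (toySetting c).Statement) ∧ ∃ (c : ℝ), ¬ (toySetting c).Statement :=
  ⟨⟨0, statement_satisfiable⟩, ⟨-1, statement_refutable⟩⟩

end Checks

end Summit.ABC.IUTFork.Cor312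

end
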